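import Summits.CriticalPhenomena.PercolationContinuityZ3.Theorems.PercNearOneGluingNoHeavyLowerTailSahiOneStepDisjointSupport
import Summits.CriticalPhenomena.PercolationContinuityZ3.Theorems.PercNearOneGluingNoHeavyLowerTailSahiOneStepSubblockThresholdFree
import HarnessLib

/-!
# One-step scheme: `(2′)` for AND-PAIRS sharing exactly one coordinate

Prover prim-ineq-prove-3 gen 25 (`--supports stmt-CriticalPhenomena-4575`; memo
`run/shared/lean/prim/prim-ineq-prove-3/FINDING-G25-DECOUPLING.md` §0, §4).  No definitions, no named facts, no sorries, no `native_decide`.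

The first case of `(2′)` beyond disjoint supports (`…SahiOneStepDisjointSupport`, negative association of the ball): the pair
`A = {e ∈ ω} ∩ A′`, `B = {e ∈ ω} ∩ B′` with `A′`, `B′` increasing and determined by DISJOINT coordinate sets avoiding `e`
(common support exactly `{e}`, AND-type dependence on it).  By the pivot identity along `e` (`…SahiOneStepThresholdStep`,
`osN_ind_ind_nonneg_of_step`): the `e`-sections are `(A′, B′)` and `(∅, ∅)`, the section term is the disjoint-support theorem for the block
`F ∖ {e}`, and the step form `M₂` collapses to `(1 − μH⁰)·μ(H¹ ∩ A′ ∩ B′) − (μH¹ − μH⁰)·μA′·μB′ ≥ μH⁰(1 − μH¹)μA′μB′ ≥ 0` by Harris.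
* `osN_threshold_andPair_nonneg` — `0 ≤ n(1_A, 1_B)` for the first slot `{N_{insert e F} ≥ t+1}`, `e ∉ F`;
* `sahiE3_threshold_andPair_nonneg` — Kahn C5 / Sahi `C₃` `0 ≤ E₃(1_{N ≥ t+1}, 1_A, 1_B)` for such pairs.
-/

noncomputable section

namespace Summit.CriticalPhenomena.PercolationContinuityZ3.Theorems

namespace SahiOneStep

open MeasureTheory Finset
open Literature.Probability.Percolation (DeterminedBy determinedBy_iff)
open Literature.Probability.LatticeModels (prodBernoulli sahiE3 prodBernoulli_harris prodBernoulli_real_inter_of_determinedBy_disjoint)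
open Literature.Probability.Percolation.DecisionTree (ind)
open scoped Classical

variable {ι : Type*} [Fintype ι]

omit [Fintype ι] in
/-- An event determined by coordinates avoiding `e` is unchanged by inserting `e`. [folklore] -/
theorem mem_iff_insert_mem_of_determinedBy {A : Set (Set ι)} {S : Finset ι} (hAS : DeterminedBy A (↑S : Set ι)) {e : ι}
    (he : e ∉ S) (ω : Set ι) : insert e ω ∈ A ↔ ω ∈ A := by
  refine (determinedBy_iff A _).1 hAS (insert e ω) ω ?_
  ext i
  simp only [Set.mem_inter_iff, Set.mem_insert_iff, Finset.mem_coe]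
  constructor
  · rintro ⟨h | h, hi⟩
    · exact absurd hi (h ▸ he)
    · exact ⟨h, hi⟩
  · rintro ⟨h, hi⟩; exact ⟨Or.inr h, hi⟩

/-- **`(2′)` FOR AND-PAIRS WITH ONE COMMON COORDINATE.**  For every product measure, every block `insert e F` (`e ∉ F`), every `t`, and
increasing `A′`, `B′` determined by disjoint coordinate sets not containing `e`:
`0 ≤ n(1_{{e ∈ ω} ∩ A′}, 1_{{e ∈ ω} ∩ B′})` for the first slot `{N_{insert e F} ≥ t+1}`. [this work] -/
theorem osN_threshold_andPair_nonneg (p : ι → unitInterval) {F : Finset ι} {e : ι} (he : e ∉ F) (t : ℕ)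
    {A B : Set (Set ι)} (hA : IsUpperSet A) (hB : IsUpperSet B) {SA SB : Finset ι}
    (hAS : DeterminedBy A (↑SA : Set ι)) (hBS : DeterminedBy B (↑SB : Set ι)) (hdisj : Disjoint SA SB)
    (heA : e ∉ SA) (heB : e ∉ SB) :
    0 ≤ osN p {ω : Set ι | t + 1 ≤ ((insert e F).filter (· ∈ ω)).card}
      (ind ({ω : Set ι | e ∈ ω} ∩ A)) (ind ({ω : Set ι | e ∈ ω} ∩ B)) := by
  -- the `e`-sections of the slot and of the two events
  have sH1 : {ω : Set ι | insert e ω ∈ {ω : Set ι | t + 1 ≤ ((insert e F).filter (· ∈ ω)).card}} =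
      {ω : Set ι | t ≤ (F.filter (· ∈ ω)).card} := section_insert_threshold he t
  have sH0 : {ω : Set ι | ω \ {e} ∈ {ω : Set ι | t + 1 ≤ ((insert e F).filter (· ∈ ω)).card}} =
      {ω : Set ι | t + 1 ≤ (F.filter (· ∈ ω)).card} := section_sdiff_threshold he t
  have sA1 : {ω : Set ι | insert e ω ∈ ({ω : Set ι | e ∈ ω} ∩ A)} = A := by
    ext ω
    simp only [Set.mem_setOf_eq, Set.mem_inter_iff, Set.mem_insert_iff, true_or, true_and]
    exact mem_iff_insert_mem_of_determinedBy hAS heA ω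
  have sB1 : {ω : Set ι | insert e ω ∈ ({ω : Set ι | e ∈ ω} ∩ B)} = B := by
    ext ω
    simp only [Set.mem_setOf_eq, Set.mem_inter_iff, Set.mem_insert_iff, true_or, true_and]
    exact mem_iff_insert_mem_of_determinedBy hBS heB ω
  have sA0 : {ω : Set ι | ω \ {e} ∈ ({ω : Set ι | e ∈ ω} ∩ A)} = ∅ := by
    ext ω
    simp only [Set.mem_setOf_eq, Set.mem_inter_iff, Set.mem_sdiff, Set.mem_singleton_iff, not_true_eq_false, and_false,
      false_and, Set.mem_empty_iff_false]
  have sB0 : {ω : Set ι | ω \ {e} ∈ ({ω : Set ι | e ∈ ω} ∩ B)} = ∅ := by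
    ext ω
    simp only [Set.mem_setOf_eq, Set.mem_inter_iff, Set.mem_sdiff, Set.mem_singleton_iff, not_true_eq_false, and_false,
      false_and, Set.mem_empty_iff_false]
  set H1 : Set (Set ι) := {ω : Set ι | t ≤ (F.filter (· ∈ ω)).card} with hH1
  set H0 : Set (Set ι) := {ω : Set ι | t + 1 ≤ (F.filter (· ∈ ω)).card} with hH0
  -- basic bounds
  have hH01 : H0 ⊆ H1 := fun ω hω => by
    simp only [hH0, hH1, Set.mem_setOf_eq] at hω ⊢; omega
  have mH : (prodBernoulli p).real H0 ≤ (prodBernoulli p).real H1 := measureReal_mono hH01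
  have mH1le : (prodBernoulli p).real H1 ≤ 1 := measureReal_le_one
  have mH0 : 0 ≤ (prodBernoulli p).real H0 := measureReal_nonneg
  have mA0 : 0 ≤ (prodBernoulli p).real A := measureReal_nonneg
  have mB0 : 0 ≤ (prodBernoulli p).real B := measureReal_nonneg
  have hAB : (prodBernoulli p).real (A ∩ B) = (prodBernoulli p).real A * (prodBernoulli p).real B :=
    prodBernoulli_real_inter_of_determinedBy_disjoint p hdisj hAS hBS MeasurableSet.of_discrete MeasurableSet.of_discrete
  have harris : (prodBernoulli p).real H1 * (prodBernoulli p).real (A ∩ B) ≤ (prodBernoulli p).real (H1 ∩ (A ∩ B)) :=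
    prodBernoulli_harris p (isUpperSet_threshold F t) (hA.inter hB) MeasurableSet.of_discrete MeasurableSet.of_discrete
  have e3 : (prodBernoulli p).real (H1 ∩ (A ∩ B)) = (prodBernoulli p).real (H1 ∩ A ∩ B) := by rw [Set.inter_assoc]
  -- apply the pivot/step lemma
  refine osN_ind_ind_nonneg_of_step p {ω : Set ι | t + 1 ≤ ((insert e F).filter (· ∈ ω)).card}
    ({ω : Set ι | e ∈ ω} ∩ A) ({ω : Set ι | e ∈ ω} ∩ B) e ?_ ?_ ?_ ?_ ?_ ?_
  · rw [sH1, sA1, sB1]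
    exact osN_disjoint_nonneg p F t hA hB hAS hBS hdisj
  · rw [sH0, sA0, sB0, osN_ind_ind]
    simp
  · rw [sH1, sH0, sA1, sB1, sA0, sB0]
    simp only [Set.inter_empty, measureReal_empty, sub_zero, mul_zero, zero_mul, add_zero, zero_add]
    rw [hAB] at harris
    rw [← e3]
    have h1 : 0 ≤ (prodBernoulli p).real H0 * (1 - (prodBernoulli p).real H1) * ((prodBernoulli p).real A * (prodBernoulli p).real B) :=
      mul_nonneg (mul_nonneg mH0 (sub_nonneg.2 mH1le)) (mul_nonneg mA0 mB0)
    nlinarith [harris, h1, mul_nonneg mA0 mB0, mH]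
  · rw [sH1, sH0]; exact mH
  · rw [sA1, sA0, measureReal_empty]; exact mA0
  · rw [sB1, sB0, measureReal_empty]; exact mB0

/-- **KAHN C5 / SAHI `C₃` FOR AND-PAIRS WITH ONE COMMON COORDINATE**: under the hypotheses of `osN_threshold_andPair_nonneg`,
`0 ≤ E₃(1_{N_{insert e F} ≥ t+1}, 1_{{e∈ω}∩A′}, 1_{{e∈ω}∩B′})`. [this work] -/
theorem sahiE3_threshold_andPair_nonneg (p : ι → unitInterval) {F : Finset ι} {e : ι} (he : e ∉ F) (t : ℕ)
    {A B : Set (Set ι)} (hA : IsUpperSet A) (hB : IsUpperSet B) {SA SB : Finset ι}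
    (hAS : DeterminedBy A (↑SA : Set ι)) (hBS : DeterminedBy B (↑SB : Set ι)) (hdisj : Disjoint SA SB)
    (heA : e ∉ SA) (heB : e ∉ SB) :
    0 ≤ sahiE3 (prodBernoulli p) {ω : Set ι | t + 1 ≤ ((insert e F).filter (· ∈ ω)).card}
      ({ω : Set ι | e ∈ ω} ∩ A) ({ω : Set ι | e ∈ ω} ∩ B) := by
  have heU : IsUpperSet {ω : Set ι | e ∈ ω} := fun ω ω' hle hω => hle hω
  rw [← osT_ind_ind, osT_eq_osMp_add_osN]
  exact add_nonneg (osMp_threshold_nonneg_all p (insert e F) (t + 1) (heU.inter hA) (heU.inter hB))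
    (osN_threshold_andPair_nonneg p he t hA hB hAS hBS hdisj heA heB)

end SahiOneStep

end Summit.CriticalPhenomena.PercolationContinuityZ3.Theorems
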